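import Mathlib.Algebra.Ring.GrindInstances
import Mathlib.NumberTheory.Padics.PadicVal.Basic
import Mathlib.Algebra.Order.Ring.Basic
import Mathlib.Algebra.Order.Ring.Cast
import Mathlib.Algebra.Order.BigOperators.Ring.Finset
import Mathlib.Tactic.Ring
import Mathlib.Tactic.Linarith
import Mathlib.Tactic.LinearCombination
import Mathlib.Tactic.NormNum.Prime
import Mathlib.Tactic.IntervalCases
import Mathlib.Tactic.SplitIfs
import HarnessLib

/-!
# `NoHeavyLowerTail` (stmt-CriticalPhenomena-4575) — kernel replay of large exact polynomial certificates (face certificates): the engine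

Support file (prover prim-cert-2, certificate seat; `--supports stmt-CriticalPhenomena-4575`).  No sorries, no named facts, standard
axioms.  Definitions: a compact sparse-polynomial data structure for KERNEL evaluation (`PPoly`, `MTree`) with its operations, their
real/ring semantics (`mono`, `PPoly.denote`, `MTree.denote`) and soundness theorems; the 15-variable evaluation context `ctx15`.

PURPOSE.  The facecert pipeline (prim-facecert, `run/shared/lean/prim/prim-l12/prim-facecert/`, FACECERT-SPEC.md) finds EXACT
Positivstellensatz-type certificates `M·T = Σ_r m_r·g_r + C` for the four-point cubic targets (L1), (L2), (B1), (B2) in the 15 partition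
cells of `(a,b,c,y)`; the full-simplex certificate of (L1) has 3 128 terms with 107-bit rationals (degree 5, 15 variables) — beyond `ring`
and beyond the kernel with core's list-of-powers monomials (measured: memory blow-up at ≈ 10⁶ merge steps).  Hence this leaner reflection:

* a monomial is ONE natural number, its Gödel code `∏ pᵢ^{eᵢ}` over the primes `ptab 0..14 = 2,3,5,…,47`; monomial product = `Nat.mul`,
  monomial order = numeric order (multiplicative, so term-wise scaling preserves sortedness); a polynomial `PPoly` is a strictly
  descending association list `(code, integer coefficient)`; all operations (`smulP`, `mergeP`, `mulPP`, `powPP`, `toPP`, `applyT`)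
  are written with raw recursors and `Nat.blt / Int.beq'` tests so that `decide +kernel` evaluates them with few reduction steps;
* the semantics decodes a code through `padicValNat`: `mono ctx k = ∏_{i<15} xᵢ ^ v_{pᵢ}(k)` (`0 ↦ 0`), which is multiplicative by
  `padicValNat.mul` — this is what makes `denote (smulP c m p) = c · mono m · denote p` an unconditional theorem;
* `toPP : Lean.Grind.CommRing.Expr → PPoly` evaluates a reflected ring expression (core's `grind` syntax tree, whose `Expr.denote` unfolds
  by `rfl` to the tree's definitions such as `CubicFourPoint.polL₁` when transcribed node by node), sound for expressions whose variables
  are `< 15` (`wfE`);  `MTree` = a multiplier given as a balanced tree of scaled monomials (`applyT t p = (Σ leaves)·p` with balanced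
  merges), so that certificate data needs no deep nesting and kernel merging stays `O(N log N)`.
Soundness: `denote_mergeP/smulP/mulPP/toPP/applyT/rhoP`, the zero test `denote_eq_of_subCheckP`, and positivity from nonnegative
coefficients at a nonnegative point (`denote_nonneg_of_coeffsP`, `MTree.denote_nonneg_of_coeffsT`).  [folklore] (proof by reflection)
-/

open Lean.Grind.CommRing (Expr Context)

namespace Summit.CriticalPhenomena.PercolationContinuityZ3.Theorems

namespace FaceCertKernel

/-! ### Data structures and kernel-side operations -/

/-- The first fifteen primes: Gödel base of variable `i` (and `1` beyond). [folklore] -/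
def ptab (i : Nat) : Nat :=
  if i = 0 then 2 else if i = 1 then 3 else if i = 2 then 5 else if i = 3 then 7 else if i = 4 then 11 else
  if i = 5 then 13 else if i = 6 then 17 else if i = 7 then 19 else if i = 8 then 23 else if i = 9 then 29 else
  if i = 10 then 31 else if i = 11 then 37 else if i = 12 then 41 else if i = 13 then 43 else if i = 14 then 47 else 1

/-- Sparse integer polynomial: association list `(monomial Gödel code, coefficient)`, codes strictly descending in normal form. [folklore] -/
inductive PPoly where
  | nil : PPoly
  | cons (k : Nat) (c : Int) (tl : PPoly) : PPoly

/-- A multiplier polynomial presented as a balanced tree of scaled monomials `c · x^k` (`k` a Gödel code). [folklore] -/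
inductive MTree where
  | leaf (c : Int) (k : Nat) : MTree
  | node (l r : MTree) : MTree

/-- `smulP c m p = (c · x^m) · p`: codes multiply, coefficients multiply (order preserved). [folklore] -/
noncomputable def smulP (c : Int) (m : Nat) (p : PPoly) : PPoly :=
  PPoly.rec (motive := fun _ => PPoly) .nil (fun k c' _ ih => .cons (Nat.mul k m) (Int.mul c c') ih) p

/-- Merge (= sum) of two descending lists, adding coefficients of equal codes and dropping zero sums.  Nested raw recursors, no fuel. [folklore] -/
noncomputable def mergeP (p q : PPoly) : PPoly :=
  PPoly.rec (motive := fun _ => PPoly → PPoly)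
    (fun q => q)
    (fun k c tl ih => fun q =>
      PPoly.rec (motive := fun _ => PPoly) (.cons k c tl)
        (fun k' c' tl' ih' =>
          Bool.rec (motive := fun _ => PPoly)
            (Bool.rec (motive := fun _ => PPoly)
              (Bool.rec (motive := fun _ => PPoly) (.cons k (Int.add c c') (ih tl')) (ih tl') (Int.beq' (Int.add c c') 0))
              (.cons k' c' ih') (Nat.blt k k'))
            (.cons k c (ih (.cons k' c' tl'))) (Nat.blt k' k))
        q)
    p q

/-- Product of two polynomials (`Σ` over the terms of the first; linear chain — use only for small factors). [folklore] -/
noncomputable def mulPP (p q : PPoly) : PPoly :=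
  PPoly.rec (motive := fun _ => PPoly) .nil (fun k c _ ih => mergeP (smulP c k q) ih) p

/-- The constant polynomial `k`. [folklore] -/
noncomputable def constP (k : Int) : PPoly := .cons 1 k .nil

/-- Power by repeated multiplication. [folklore] -/
noncomputable def powPP (p : PPoly) (n : Nat) : PPoly :=
  Nat.rec (motive := fun _ => PPoly) (constP 1) (fun _ ih => mulPP ih p) n

/-- Evaluation of a reflected ring expression (core `grind` syntax) into a `PPoly`. [folklore] -/
noncomputable def toPP (e : Expr) : PPoly :=
  Expr.rec (motive := fun _ => PPoly)
    (fun k => constP k) (fun n => constP n) (fun k => constP k) (fun i => .cons (ptab i) 1 .nil)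
    (fun _ ih => smulP (-1) 1 ih) (fun _ _ ih₁ ih₂ => mergeP ih₁ ih₂) (fun _ _ ih₁ ih₂ => mergeP ih₁ (smulP (-1) 1 ih₂))
    (fun _ _ ih₁ ih₂ => mulPP ih₁ ih₂) (fun _ k ih => powPP ih k) e

/-- Well-formedness for `toPP`: every variable index is `< 15`. [folklore] -/
noncomputable def wfE (e : Expr) : Bool :=
  Expr.rec (motive := fun _ => Bool)
    (fun _ => true) (fun _ => true) (fun _ => true) (fun i => Nat.blt i 15) (fun _ ih => ih)
    (fun _ _ ih₁ ih₂ => ih₁ && ih₂) (fun _ _ ih₁ ih₂ => ih₁ && ih₂) (fun _ _ ih₁ ih₂ => ih₁ && ih₂) (fun _ _ ih => ih) e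

/-- `(xᵢ − xⱼ) · p` (multiplication by a region form). [folklore] -/
noncomputable def rhoP (i j : Nat) (p : PPoly) : PPoly :=
  mergeP (smulP 1 (ptab i) p) (smulP (-1) (ptab j) p)

/-- Zero-polynomial test. [folklore] -/
noncomputable def isNilP (p : PPoly) : Bool :=
  PPoly.rec (motive := fun _ => Bool) true (fun _ _ _ _ => false) p

/-- The certificate zero test: `p − q` merges to the empty polynomial. [folklore] -/
noncomputable def subCheckP (p q : PPoly) : Bool := isNilP (mergeP p (smulP (-1) 1 q))

/-- All coefficients nonnegative and all codes nonzero. [folklore] -/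
noncomputable def coeffsP (p : PPoly) : Bool :=
  PPoly.rec (motive := fun _ => Bool) true (fun k c _ ih => decide (0 ≤ c) && !(Nat.beq k 0) && ih) p

/-- `applyT t p = (polynomial of the tree t) · p`, as a balanced tree of merges of scaled copies of `p`. [folklore] -/
noncomputable def applyT (t : MTree) (p : PPoly) : PPoly :=
  MTree.rec (motive := fun _ => PPoly) (fun c k => smulP c k p) (fun _ _ ihl ihr => mergeP ihl ihr) t

/-- All leaf coefficients of a multiplier tree nonnegative and all codes nonzero. [folklore] -/
noncomputable def coeffsT (t : MTree) : Bool :=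
  MTree.rec (motive := fun _ => Bool) (fun c k => decide (0 ≤ c) && !(Nat.beq k 0)) (fun _ _ ihl ihr => ihl && ihr) t

/-! ### Semantics -/

section Semantics

variable {R : Type*} [CommRing R]

/-- The monomial with Gödel code `k` at the point `ctx`: `∏_{i<15} xᵢ ^ v_{pᵢ}(k)`, and `0` for the (never produced) code `0`. [folklore] -/
noncomputable def mono (ctx : Context R) (k : Nat) : R :=
  if k = 0 then 0 else ∏ i ∈ Finset.range 15, ctx.get i ^ padicValNat (ptab i) k

/-- Value of a `PPoly` at `ctx`. [folklore] -/
noncomputable def PPoly.denote (ctx : Context R) : PPoly → R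
  | .nil => 0
  | .cons k c tl => (c : R) * mono ctx k + PPoly.denote ctx tl

/-- Value of the polynomial presented by a multiplier tree. [folklore] -/
noncomputable def MTree.denote (ctx : Context R) : MTree → R
  | .leaf c k => (c : R) * mono ctx k
  | .node l r => MTree.denote ctx l + MTree.denote ctx r

/-- The table entries `ptab 0..14` are prime. -/
theorem ptab_prime : ∀ i, i < 15 → (ptab i).Prime := by
  intro i hi; interval_cases i <;> norm_num [ptab]

/-- The table is injective on `0..14`. -/
theorem ptab_inj : ∀ i, i < 15 → ∀ j, j < 15 → ptab i = ptab j → i = j := by decide +kernel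

/-- The code `1` is the empty monomial. -/
theorem mono_one (ctx : Context R) : mono ctx 1 = 1 := by simp [mono]
/-- Multiplicativity of the decoding (the reason Gödel codes work). [folklore] -/
theorem mono_mul (ctx : Context R) (k m : Nat) : mono ctx (k * m) = mono ctx k * mono ctx m := by
  by_cases hk : k = 0; · subst hk; simp [mono]
  by_cases hm : m = 0; · subst hm; simp [mono]
  have hkm : k * m ≠ 0 := Nat.mul_ne_zero hk hm
  simp only [mono, hk, hm, hkm, if_false]
  rw [← Finset.prod_mul_distrib]
  refine Finset.prod_congr rfl fun i hi => ?_
  have hp : Fact (ptab i).Prime := ⟨ptab_prime i (Finset.mem_range.mp hi)⟩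
  rw [padicValNat.mul hk hm, pow_add]

/-- The code `pᵢ` is the variable `xᵢ`. -/
theorem mono_ptab (ctx : Context R) (i : Nat) (hi : i < 15) : mono ctx (ptab i) = ctx.get i := by
  have hpi : (ptab i).Prime := ptab_prime i hi
  have hne : ptab i ≠ 0 := hpi.ne_zero
  simp only [mono, hne, if_false]
  rw [Finset.prod_eq_single i]
  · haveI : Fact (ptab i).Prime := ⟨hpi⟩
    rw [padicValNat_self, pow_one]
  · intro j hj hji
    haveI : Fact (ptab j).Prime := ⟨ptab_prime j (Finset.mem_range.mp hj)⟩
    haveI : Fact (ptab i).Prime := ⟨hpi⟩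
    have hne' : ptab j ≠ ptab i := fun h => hji (ptab_inj j (Finset.mem_range.mp hj) i hi h)
    rw [padicValNat_primes hne', pow_zero]
  · intro h; exact absurd (Finset.mem_range.mpr hi) h

/-! ### Soundness of the operations -/

/-- Unfolding lemma. -/
theorem denote_nil (ctx : Context R) : PPoly.denote ctx .nil = 0 := rfl
/-- Unfolding lemma. -/
theorem denote_cons (ctx : Context R) (k : Nat) (c : Int) (tl : PPoly) :
    PPoly.denote ctx (.cons k c tl) = (c : R) * mono ctx k + PPoly.denote ctx tl := rfl

/-- Soundness of `smulP`: scaling by `c·x^m`. [folklore] -/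
theorem denote_smulP (ctx : Context R) (c : Int) (m : Nat) (p : PPoly) :
    (smulP c m p).denote ctx = (c : R) * mono ctx m * p.denote ctx := by
  induction p with
  | nil => simp [smulP, PPoly.denote]
  | cons k c' tl ih =>
    show PPoly.denote ctx (.cons (Nat.mul k m) (Int.mul c c') (smulP c m tl)) = _
    rw [denote_cons, ih, denote_cons]
    simp only [Nat.mul_eq, Int.mul_def, Int.cast_mul, mono_mul]
    ring

/-- Unfolding lemma. -/
theorem mergeP_nil (q : PPoly) : mergeP .nil q = q := rfl
/-- Unfolding lemma. -/
theorem mergeP_cons_nil (k : Nat) (c : Int) (tl : PPoly) : mergeP (.cons k c tl) .nil = .cons k c tl := rfl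
/-- Unfolding lemma (one merge step). -/
theorem mergeP_cons_cons (k : Nat) (c : Int) (tl : PPoly) (k' : Nat) (c' : Int) (tl' : PPoly) :
    mergeP (.cons k c tl) (.cons k' c' tl') =
      Bool.rec (motive := fun _ => PPoly)
        (Bool.rec (motive := fun _ => PPoly)
          (Bool.rec (motive := fun _ => PPoly) (.cons k (Int.add c c') (mergeP tl tl')) (mergeP tl tl') (Int.beq' (Int.add c c') 0))
          (.cons k' c' (mergeP (.cons k c tl) tl')) (Nat.blt k k'))
        (.cons k c (mergeP tl (.cons k' c' tl'))) (Nat.blt k' k) := rfl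

/-- Soundness of `mergeP`: it denotes the sum. [folklore] -/
theorem denote_mergeP (ctx : Context R) (p q : PPoly) : (mergeP p q).denote ctx = p.denote ctx + q.denote ctx := by
  induction p generalizing q with
  | nil => rw [mergeP_nil, denote_nil, zero_add]
  | cons k c tl ih =>
    induction q with
    | nil => rw [mergeP_cons_nil, denote_nil, add_zero]
    | cons k' c' tl' ih' =>
      rw [mergeP_cons_cons]
      cases h1 : Nat.blt k' k
      · cases h2 : Nat.blt k k'
        · -- k = k'
          have hkk : k = k' := by
            have a := (Bool.not_eq_true _).mpr h1; have b := (Bool.not_eq_true _).mpr h2; rw [Nat.blt_eq] at a b; omega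
          subst hkk
          cases h3 : Int.beq' (Int.add c c') 0
          · show PPoly.denote ctx (.cons k (Int.add c c') (mergeP tl tl')) = _
            rw [denote_cons, ih, denote_cons, denote_cons]
            simp only [Int.add_def, Int.cast_add]; ring
          · show PPoly.denote ctx (mergeP tl tl') = _
            have hcc : c + c' = 0 := by simpa using h3
            rw [ih, denote_cons, denote_cons]
            have hcR : (c : R) + (c' : R) = 0 := by rw [← Int.cast_add, hcc, Int.cast_zero]
            linear_combination (-(mono ctx k)) * hcR
        · show PPoly.denote ctx (.cons k' c' (mergeP (.cons k c tl) tl')) = _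
          rw [denote_cons, ih', denote_cons, denote_cons]; ring
      · show PPoly.denote ctx (.cons k c (mergeP tl (.cons k' c' tl'))) = _
        rw [denote_cons, ih, denote_cons, denote_cons]; ring

/-- Soundness of `constP`. -/
theorem denote_constP (ctx : Context R) (k : Int) : (constP k).denote ctx = (k : R) := by
  simp [constP, PPoly.denote, mono_one]

/-- Soundness of `mulPP`. [folklore] -/
theorem denote_mulPP (ctx : Context R) (p q : PPoly) : (mulPP p q).denote ctx = p.denote ctx * q.denote ctx := by
  induction p with
  | nil => show PPoly.denote ctx .nil = _; rw [denote_nil, zero_mul]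
  | cons k c tl ih =>
    show PPoly.denote ctx (mergeP (smulP c k q) (mulPP tl q)) = _
    rw [denote_mergeP, denote_smulP, ih, denote_cons]; ring

/-- Soundness of `powPP`. [folklore] -/
theorem denote_powPP (ctx : Context R) (p : PPoly) (n : Nat) : (powPP p n).denote ctx = p.denote ctx ^ n := by
  induction n with
  | zero => show PPoly.denote ctx (constP 1) = _; rw [denote_constP, pow_zero, Int.cast_one]
  | succ n ih => show PPoly.denote ctx (mulPP (powPP p n) p) = _; rw [denote_mulPP, ih, pow_succ]

/-- Soundness of `rhoP` (both variables in range). [folklore] -/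
theorem denote_rhoP (ctx : Context R) (i j : Nat) (hi : i < 15) (hj : j < 15) (p : PPoly) :
    (rhoP i j p).denote ctx = (ctx.get i - ctx.get j) * p.denote ctx := by
  unfold rhoP
  rw [denote_mergeP, denote_smulP, denote_smulP, mono_ptab ctx i hi, mono_ptab ctx j hj]
  simp only [Int.cast_one, Int.cast_neg]; ring

/-- Soundness of `applyT`: the tree's polynomial times `p`. [folklore] -/
theorem denote_applyT (ctx : Context R) (t : MTree) (p : PPoly) : (applyT t p).denote ctx = t.denote ctx * p.denote ctx := by
  induction t with
  | leaf c k =>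
    show PPoly.denote ctx (smulP c k p) = ((c : R) * mono ctx k) * p.denote ctx
    rw [denote_smulP]
  | node l r ihl ihr =>
    show PPoly.denote ctx (mergeP (applyT l p) (applyT r p)) = (MTree.denote ctx l + MTree.denote ctx r) * p.denote ctx
    rw [denote_mergeP, ihl, ihr, add_mul]

/-- Soundness of `toPP` on well-formed expressions: it agrees with core's `Expr.denote`. [folklore] -/
theorem denote_toPP (ctx : Context R) (e : Expr) (hw : wfE e = true) : (toPP e).denote ctx = e.denote ctx := by
  induction e with
  | num k => show PPoly.denote ctx (constP k) = Lean.Grind.CommRing.denoteInt k; rw [denote_constP, Lean.Grind.CommRing.denoteInt_eq]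
  | natCast n => show PPoly.denote ctx (constP n) = (n : R); rw [denote_constP]; exact Int.cast_natCast n
  | intCast k => show PPoly.denote ctx (constP k) = (k : R); rw [denote_constP]
  | var i =>
    have hi : i < 15 := by simpa [wfE] using hw
    show PPoly.denote ctx (.cons (ptab i) 1 .nil) = ctx.get i
    rw [denote_cons, denote_nil, mono_ptab ctx i hi]; simp
  | neg a ih =>
    show PPoly.denote ctx (smulP (-1) 1 (toPP a)) = - a.denote ctx
    rw [denote_smulP, ih (by simpa [wfE] using hw), mono_one]; simp
  | add a b iha ihb =>
    have hw' : wfE a = true ∧ wfE b = true := by simpa [wfE] using hw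
    show PPoly.denote ctx (mergeP (toPP a) (toPP b)) = a.denote ctx + b.denote ctx
    rw [denote_mergeP, iha hw'.1, ihb hw'.2]
  | sub a b iha ihb =>
    have hw' : wfE a = true ∧ wfE b = true := by simpa [wfE] using hw
    show PPoly.denote ctx (mergeP (toPP a) (smulP (-1) 1 (toPP b))) = a.denote ctx - b.denote ctx
    rw [denote_mergeP, denote_smulP, iha hw'.1, ihb hw'.2, mono_one]; simp [sub_eq_add_neg]
  | mul a b iha ihb =>
    have hw' : wfE a = true ∧ wfE b = true := by simpa [wfE] using hw
    show PPoly.denote ctx (mulPP (toPP a) (toPP b)) = a.denote ctx * b.denote ctx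
    rw [denote_mulPP, iha hw'.1, ihb hw'.2]
  | pow a k ih =>
    show PPoly.denote ctx (powPP (toPP a) k) = a.denote ctx ^ k
    rw [denote_powPP, ih (by simpa [wfE] using hw)]

/-- Soundness of the zero test: `subCheckP p q` ⇒ `p` and `q` denote the same element. [folklore] -/
theorem denote_eq_of_subCheckP (ctx : Context R) (p q : PPoly) (h : subCheckP p q = true) : p.denote ctx = q.denote ctx := by
  have hz : (mergeP p (smulP (-1) 1 q)).denote ctx = 0 := by
    unfold subCheckP at h
    generalize hr : mergeP p (smulP (-1) 1 q) = r at h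
    cases r with
    | nil => rfl
    | cons _ _ _ => exact absurd h (by simp [isNilP])
  rw [denote_mergeP, denote_smulP, mono_one] at hz
  simp only [Int.reduceNeg, Int.cast_neg, Int.cast_one, mul_one, neg_mul, one_mul] at hz
  linear_combination hz

end Semantics

/-! ### Nonnegativity from nonnegative coefficients -/

section Order

variable {R : Type*} [CommRing R] [LinearOrder R] [IsStrictOrderedRing R]

/-- A monomial is nonnegative at a nonnegative point. -/
theorem mono_nonneg (ctx : Context R) (hx : ∀ i, i < 15 → 0 ≤ ctx.get i) (k : Nat) : 0 ≤ mono ctx k := by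
  unfold mono
  split_ifs
  · exact le_refl _
  · exact Finset.prod_nonneg fun i hi => pow_nonneg (hx i (Finset.mem_range.mp hi)) _

/-- A `PPoly` with nonnegative coefficients is nonnegative at a nonnegative point. [folklore] -/
theorem denote_nonneg_of_coeffsP (ctx : Context R) (hx : ∀ i, i < 15 → 0 ≤ ctx.get i) (p : PPoly) (h : coeffsP p = true) :
    0 ≤ p.denote ctx := by
  induction p with
  | nil => exact le_refl _
  | cons k c tl ih =>
    have h' : (0 ≤ c ∧ Nat.beq k 0 = false) ∧ coeffsP tl = true := by simpa [coeffsP] using h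
    have hc : (0 : R) ≤ (c : R) := by exact_mod_cast h'.1.1
    rw [denote_cons]; exact add_nonneg (mul_nonneg hc (mono_nonneg ctx hx k)) (ih h'.2)

/-- A multiplier tree with nonnegative leaf coefficients is nonnegative at a nonnegative point. [folklore] -/
theorem MTree.denote_nonneg_of_coeffsT (ctx : Context R) (hx : ∀ i, i < 15 → 0 ≤ ctx.get i) (t : MTree) (h : coeffsT t = true) :
    0 ≤ t.denote ctx := by
  induction t with
  | leaf c k =>
    have h' : 0 ≤ c ∧ Nat.beq k 0 = false := by simpa [coeffsT] using h
    have hc : (0 : R) ≤ (c : R) := by exact_mod_cast h'.1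
    exact mul_nonneg hc (mono_nonneg ctx hx k)
  | node l r ihl ihr =>
    have h' : coeffsT l = true ∧ coeffsT r = true := by simpa [coeffsT] using h
    exact add_nonneg (ihl h'.1) (ihr h'.2)

end Order

/-! ### The 15-variable evaluation context -/

section Ctx

variable {R : Type*}

/-- Balanced random-access array on the 15 cell variables (variable `i` = the `(i+1)`-st cell in the order
`a|b|c|y, a|b|cy, a|by|c, a|bc|y, ay|b|c, ac|b|y, ab|c|y, a|bcy, ay|bc, ac|by, acy|b, ab|cy, aby|c, abc|y, abcy`). [folklore] -/
def ctx15 (x₁ x₂ x₃ x₄ x₅ x₆ x₇ x₈ x₉ x₁₀ x₁₁ x₁₂ x₁₃ x₁₄ x₁₅ : R) : Context R :=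
  .branch 7 (.branch 3 (.branch 1 (.leaf x₁) (.branch 2 (.leaf x₂) (.leaf x₃)))
                       (.branch 5 (.branch 4 (.leaf x₄) (.leaf x₅)) (.branch 6 (.leaf x₆) (.leaf x₇))))
            (.branch 11 (.branch 9 (.branch 8 (.leaf x₈) (.leaf x₉)) (.branch 10 (.leaf x₁₀) (.leaf x₁₁)))
                        (.branch 13 (.branch 12 (.leaf x₁₂) (.leaf x₁₃)) (.branch 14 (.leaf x₁₄) (.leaf x₁₅))))

variable [CommRing R] [LinearOrder R] [IsStrictOrderedRing R]

omit [IsStrictOrderedRing R] in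
/-- Every lookup in `ctx15` returns one of the fifteen cells, hence is nonnegative when they are. [folklore] -/
theorem ctx15_get_nonneg {x₁ x₂ x₃ x₄ x₅ x₆ x₇ x₈ x₉ x₁₀ x₁₁ x₁₂ x₁₃ x₁₄ x₁₅ : R}
    (h₁ : 0 ≤ x₁) (h₂ : 0 ≤ x₂) (h₃ : 0 ≤ x₃) (h₄ : 0 ≤ x₄) (h₅ : 0 ≤ x₅) (h₆ : 0 ≤ x₆) (h₇ : 0 ≤ x₇) (h₈ : 0 ≤ x₈)
    (h₉ : 0 ≤ x₉) (h₁₀ : 0 ≤ x₁₀) (h₁₁ : 0 ≤ x₁₁) (h₁₂ : 0 ≤ x₁₂) (h₁₃ : 0 ≤ x₁₃) (h₁₄ : 0 ≤ x₁₄) (h₁₅ : 0 ≤ x₁₅) :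
    ∀ i, i < 15 → 0 ≤ (ctx15 x₁ x₂ x₃ x₄ x₅ x₆ x₇ x₈ x₉ x₁₀ x₁₁ x₁₂ x₁₃ x₁₄ x₁₅).get i := by
  intro i _
  rw [Lean.RArray.get_eq_getImpl]
  simp only [ctx15, Lean.RArray.getImpl]
  split_ifs <;> assumption

end Ctx

end FaceCertKernel

end Summit.CriticalPhenomena.PercolationContinuityZ3.Theorems
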